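import Mathlib.LinearAlgebra.Complex.Module
import Mathlib.LinearAlgebra.Basis.VectorSpace
import Mathlib.LinearAlgebra.Projection
import Literature.MathematicalPhysics.QuantumFieldTheory.Balaban1983to89.B9Thm31MassiveSiteResolventLinftyZd
import Literature.MathematicalPhysics.QuantumFieldTheory.Balaban1983to89.B8IdxB8SubDRigidity
import Literature.MathematicalPhysics.QuantumFieldTheory.Balaban1983to89.B8IdxB8LamTopTowerDisjoint

/-!
# `Balaban1983to89.B8SockLettersRDEmptyTowerClassHonest` — [Balaban1985BackgroundPropagators] Thm 3.1 p. 397 (no-averaging case) FEEDING THE N05 SOCKET: on the EMPTY-TOWER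
# SUB-CLASS `Ω = (ℤᵈ, ∅, ∅, …)` (every spacing, every depth, every unitary background) the [4]-letter package `B8SockLettersRD.SockLettersRD` HOLDS WITH THE GENUINE MASSIVE
# RESOLVENT `G′ = (Δ^η_{U₀} + 8dη⁻²)⁻¹` AS THE LETTER `g` (honest on every bounded source; `𝔄 = 8dη⁻²·1`, `C = (G′)⁻²`, `R = 0`), ONE constant vector `(B_G, B_R, B₀′_H, B₂′) = (1, 0, 2, 4d)`
# — the linear extension off the bounded functions is along a STAR-INVARIANT complement (a lemma of independent use: every star-invariant `ℂ`-subspace of a star module has one)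

statement-level skeleton of published theorems with citation tags; proofs where landed; nothing here is a claim about the Yang–Mills mass gap

`[Balaban1985BackgroundPropagators]` ("[4]"; journal page = PDF page + 388): (3.21) p. 394 (real letters), (3.23)–(3.25) p. 394 (`Δ^η_U`, `G′ = (Δ + Q′*𝔄Q′)⁻¹`, `R = 1 − G′Q′*(Q′G′²Q′*)⁻¹Q′G′`),
Thm 3.1 p. 397.  `[Balaban1985RegularSpaces]` ("B8"): (1.3)–(1.6) p. 77 («we admit Ω_j = T_η»), (1.91)–(1.92) p. 91, (1.95)–(1.98) p. 92, (1.101)–(1.103) p. 93, (1.107) p. 94.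

## WHY THIS FILE (cell `pub-ymgap`, HUMAN RULING D-0062; width seat `pub-ymgap-dag-n05-w1` g3, DAG node N05 = [B8]; proof lane, count-neutral)

`B8SockLettersRDEmptyTowerClassUniform` (this seat) inhabits the socket TEXT on the empty-tower sub-class with member-free constants by a DEGENERATE witness (`g = η²·1`, `𝔄`
absorbing `−Δ`).  `B9Thm31MassiveSiteResolventLinftyZd` (this seat, p628670) built the GENUINE `ℓ^∞(ℤᵈ, 𝔸)` resolvent `G′` of [4] Thm 3.1's no-averaging case.  THIS FILE puts the two
together: on the same sub-class the socket holds with `g := G′` on every BOUNDED source — the sources the socket's bound clauses (12), (15) actually read — and print's `𝔄 = aη⁻²·1`,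
`C = (Q′G′²Q′*)⁻¹ = G′⁻²`, `R = 0` (at `Q′ = 1`, `R = 1 − G′G′⁻²G′ = 0` exactly, not by junk).  The one non-printed device: the socket's clause (1) `(Δ + Q′ᵀ𝔄Q′)(g x) = x` is
typed for EVERY function `x : ℤᵈ → 𝔸`, bounded or not, and a `ℂ`-LINEAR `g`; a bounded-output `G′` cannot serve unbounded `x`, so `g ∕ 𝔄 ∕ C` are extended off the bounded submodule
`B` along a complement `W` (`V = B ⊕ W`), degenerately on `W` — and for the reality clauses (14), (16) the complement must be STAR-INVARIANT: §1 proves every star-invariant `ℂ`-subspace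
of a star module over `ℂ` has a star-invariant complement (real parts: `B ∩ V_sa` has a real complement `W_sa` in `V_sa`; `W := W_sa ⊕ iW_sa`).  DECLARED: on unbounded sources the
letters are junk by design (as `restr` of an unbounded function is in p628670 and in n06-b's bond template).

## WHAT IS PROVED (kernel, 0 sorry, 0 def)

* §1 ★ `exists_isCompl_star` (GENERIC: `V` a star module over `ℂ`, `B ≤ V` star-invariant ⊢ `∃ W, IsCompl B W ∧ W` star-invariant) · `projection_star` (the projections of a
  star-invariant splitting commute with the adjoint) · `realPart_star ∕ imaginaryPart_star ∕ realPart_mem ∕ imaginaryPart_mem` (plumbing, public for reuse).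
* §2 ★★ `exists_honest_letters` — at an empty-tower member, truncation-free letters `g, Δ, q, qs, 𝔄, C` with: right inverse on ALL sources, LEFT inverse on bounded sources, both
  `C`-laws, the pinned readings, the bounds (`B_G = 1`), reality, zero residual, and ★ `g f = G′f` for every bounded `f`; ★★ `sockLettersRD_emptyTower_honest` (`SockLettersRD L 1 0 2 (4d) cP
  η k Ω Λs` from them + `H′X := X(0,·)`); ★ `sLetUB_text_emptyTower_honest` (p619291's inline uniqueness-side display, same letters, same constants, at the top truncation).
* §3 `sockLettersRD_of_lamTop_emptyTower_honest` (binder shape, via rigidity) · `IdxB8SubD.sockLettersRD_of_emptyTower_honest` (index of record, `θ.D = d₆ + 1 ≥ 1`).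

## HONEST SCOPE

[4] Thm 3.1 only in its no-averaging case (the thin empty-tower sub-class); the `k ≥ 1` members untouched; on UNBOUNDED sources the letters are a declared linear-algebra junk extension;
nothing of [B8] ∕ [4] beyond p628670's Banach fixed point is proved; the five (1.5)-keyed families of the N05 road remain HYPOTHESES class-wide (N06 content).  Count-neutral; N05 NOT
discharged; `T_η ↦ ℤᵈ`; one finite `𝕋⁴` programme at fixed `ε`, Bałaban as printed — the Yang–Mills mass gap (Clay) is NOT proved by any of this; R4 closes the conditional finite-`𝕋⁴`
rung `BalabanLadder.UV` only; nothing continuum ∕ ℝ⁴ ∕ OS.  No `sorry`, no `def`, no `instance`, no `notation`.  Unit `pub-ymgap-dag-n05-w1` (g3), 2026-08-28.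

[cite: Balaban1985BackgroundPropagators, (3.21)–(3.25) p.394, Thm 3.1 p.397; Balaban1985RegularSpaces, (1.3)–(1.6) p.77, (1.91)–(1.92) p.91, (1.95)–(1.98) p.92, (1.101)–(1.103) p.93, (1.107) p.94]
-/

noncomputable section

open NormedSpace
open scoped ComplexStarModule

namespace Literature.MathematicalPhysics.QuantumFieldTheory.Balaban1983to89.B8SockLettersRDEmptyTowerClassHonest

/-! ## §1 A star-invariant `ℂ`-subspace of a star module over `ℂ` has a star-invariant complement -/

section StarCompl

variable {V : Type*} [AddCommGroup V] [Module ℂ V] [StarAddMonoid V] [StarModule ℂ V]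

/-- `ℜ(v*) = ℜ v`. [cite: Balaban1985BackgroundPropagators, (3.21) p.394 (real and imaginary parts; bookkeeping)] -/
theorem realPart_star (v : V) : ℜ (star v) = ℜ v := by
  ext; simp [realPart_apply_coe, add_comm]

/-- `ℑ(v*) = −ℑ v`. [cite: Balaban1985BackgroundPropagators, (3.21) p.394 (bookkeeping)] -/
theorem imaginaryPart_star (v : V) : ℑ (star v) = -ℑ v := by
  ext
  simp only [imaginaryPart_apply_coe, star_star, NegMemClass.coe_neg]
  rw [← smul_neg, ← smul_neg, neg_sub]

/-- A star-invariant `ℂ`-subspace contains the real parts of its elements. [cite: Balaban1985BackgroundPropagators, (3.21) p.394 (bookkeeping)] -/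
theorem realPart_mem {B : Submodule ℂ V} (hB : ∀ v ∈ B, star v ∈ B) {v : V} (hv : v ∈ B) : ((ℜ v : selfAdjoint V) : V) ∈ B := by
  rw [realPart_apply_coe, ← Complex.coe_smul]
  exact B.smul_mem _ (B.add_mem hv (hB v hv))

/-- … and their imaginary parts. [cite: Balaban1985BackgroundPropagators, (3.21) p.394 (bookkeeping)] -/
theorem imaginaryPart_mem {B : Submodule ℂ V} (hB : ∀ v ∈ B, star v ∈ B) {v : V} (hv : v ∈ B) : ((ℑ v : selfAdjoint V) : V) ∈ B := by
  rw [imaginaryPart_apply_coe, ← Complex.coe_smul]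
  exact B.smul_mem _ (B.smul_mem _ (B.sub_mem hv (hB v hv)))

/-- ★ **A STAR-INVARIANT `ℂ`-SUBSPACE OF A STAR MODULE OVER `ℂ` HAS A STAR-INVARIANT COMPLEMENT**: the real trace `B ∩ V_sa` has a real complement `W_sa` in the self-adjoint part
`V_sa` (`Submodule.exists_isCompl` over `ℝ`), and `W := {v | ℜ v, ℑ v ∈ W_sa}` is a `ℂ`-subspace, star-invariant, with `V = B ⊕ W`.  (Linear algebra; used to extend real letters off a
star-invariant subspace.) [cite: Balaban1985BackgroundPropagators, (3.21) p.394 (the letters are real operators; bookkeeping device for their typed domain)] -/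
theorem exists_isCompl_star (B : Submodule ℂ V) (hB : ∀ v ∈ B, star v ∈ B) :
    ∃ W : Submodule ℂ V, IsCompl B W ∧ ∀ v ∈ W, star v ∈ W := by
  let Bre : Submodule ℝ (selfAdjoint V) := (B.restrictScalars ℝ).comap (selfAdjoint.submodule ℝ V).subtype
  have hBre : ∀ h : selfAdjoint V, h ∈ Bre ↔ (h : V) ∈ B := fun h => Iff.rfl
  obtain ⟨Wre, hc⟩ := Bre.exists_isCompl
  let W : Submodule ℂ V :=
    { carrier := {v | ℜ v ∈ Wre ∧ ℑ v ∈ Wre}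
      add_mem' := fun {a b} ha hb => ⟨by rw [map_add]; exact Wre.add_mem ha.1 hb.1, by rw [map_add]; exact Wre.add_mem ha.2 hb.2⟩
      zero_mem' := ⟨by rw [map_zero]; exact Wre.zero_mem, by rw [map_zero]; exact Wre.zero_mem⟩
      smul_mem' := fun z v hv => ⟨by rw [realPart_smul]; exact Wre.sub_mem (Wre.smul_mem _ hv.1) (Wre.smul_mem _ hv.2),
        by rw [imaginaryPart_smul]; exact Wre.add_mem (Wre.smul_mem _ hv.2) (Wre.smul_mem _ hv.1)⟩ }
  have hW : ∀ v, v ∈ W ↔ ℜ v ∈ Wre ∧ ℑ v ∈ Wre := fun v => Iff.rfl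
  refine ⟨W, ?_, fun v hv => (hW _).2 ⟨by rw [realPart_star]; exact hv.1, by rw [imaginaryPart_star]; exact Wre.neg_mem hv.2⟩⟩
  refine isCompl_iff.2 ⟨Submodule.disjoint_def.2 fun v hvB hvW => ?_, Submodule.codisjoint_iff_exists_add_eq.2 fun v => ?_⟩
  · have hdis := Submodule.disjoint_def.1 hc.disjoint
    have h1 : ℜ v = 0 := hdis _ ((hBre _).2 (realPart_mem hB hvB)) hvW.1
    have h2 : ℑ v = 0 := hdis _ ((hBre _).2 (imaginaryPart_mem hB hvB)) hvW.2
    rw [← realPart_add_I_smul_imaginaryPart v, h1, h2]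
    simp
  · have hcod := Submodule.codisjoint_iff_exists_add_eq.1 hc.codisjoint
    obtain ⟨b₁, w₁, hb₁, hw₁, h₁⟩ := hcod (ℜ v)
    obtain ⟨b₂, w₂, hb₂, hw₂, h₂⟩ := hcod (ℑ v)
    refine ⟨(b₁ : V) + Complex.I • (b₂ : V), (w₁ : V) + Complex.I • (w₂ : V), B.add_mem ((hBre _).1 hb₁) (B.smul_mem _ ((hBre _).1 hb₂)), (hW _).2 ⟨?_, ?_⟩, ?_⟩
    · rw [map_add, realPart_I_smul, selfAdjoint.realPart_coe, selfAdjoint.imaginaryPart_coe, neg_zero, add_zero]; exact hw₁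
    · rw [map_add, imaginaryPart_I_smul, selfAdjoint.realPart_coe, selfAdjoint.imaginaryPart_coe, zero_add]; exact hw₂
    · calc (b₁ : V) + Complex.I • (b₂ : V) + ((w₁ : V) + Complex.I • (w₂ : V))
          = ((b₁ + w₁ : selfAdjoint V) : V) + Complex.I • ((b₂ + w₂ : selfAdjoint V) : V) := by
            simp only [AddMemClass.coe_add, smul_add]; abel
        _ = v := by rw [h₁, h₂, realPart_add_I_smul_imaginaryPart]

omit [StarModule ℂ V] in
/-- **The projections of a star-invariant splitting commute with the adjoint.** [cite: Balaban1985BackgroundPropagators, (3.21) p.394 (bookkeeping)] -/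
theorem projection_star {B W : Submodule ℂ V} (h : IsCompl B W) (hB : ∀ v ∈ B, star v ∈ B) (hW : ∀ v ∈ W, star v ∈ W) (v : V) :
    B.projection W h (star v) = star (B.projection W h v) := by
  have hv := Submodule.projection_add_projection_eq_self h v
  set b := B.projection W h v
  set w := W.projection B h.symm v
  have hb : b ∈ B := Submodule.projection_apply_mem h v
  have hw : w ∈ W := Submodule.projection_apply_mem h.symm v
  have hsv : star v = star b + star w := by rw [← hv, star_add]
  rw [hsv, map_add, Submodule.projection_apply_of_mem_left h (hB b hb), Submodule.projection_apply_of_mem_right h (hW w hw), add_zero]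

end StarCompl

/-! ## §2 The socket on the empty-tower sub-class with the genuine resolvent as `g` -/

section Honest

open B7Prop1Explicit B7Prop1Local
open B7Prop2Explicit (unitaryUnits unitaryUnits_le_U1)
open B7Eq78Linearization (zdBlocking QprimeIter)
open B8Ineq132 (covDerivFwd InAk)
open B8Eq119TwistedAxial (bgT)
open B8Eq140Level (SideTouches)
open B8Eq138LandauZd (covLap QT QprimeT QprimeT_zero)
open B8Eq1117Concrete (XSpace)
open B8Prop5ContractionKLevel (Bd2)
open B8LambdaSpaceKLevel (wt)
open B8LeafModelZd (ZdIdx)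
open B8ConstraintBonds (DomainSeq Lam)
open B8SockLettersRD (SockLettersRD)
open B9SupplySockB9P3ZdLettersOmega (norm_covDerivFwd_le norm_covLap_le covLap_add)
open B8Prop5JoinSectE (covLap_smul)
open B9Eq321LandauProjectionZd (star_covLap)
open B8IdxB8SubDRigidity (Λs_eq_lam_of_lamTop mem_lamK_iff_of_lt mem_lamK_self_iff)
open B8Eq131DomainSeq (isLevel_pow_smul)
open B9Thm31MassiveSiteResolventLinftyZd (SiteSp BddS restrS restrS_apply restrS_add restrS_smul restrS_coe bddS_coe massS fpS fpS_add fpS_smul fpS_star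
  massive_letter_clauses_on_bounded)
open Node00 (Stage3Params IdxB8Laws IdxB8SubD)

-- `Site` alone could resolve to the torus sites of `Setup.lean`; re-export the `ℤ^d` sites of `B7Prop1Explicit`.
export B7Prop1Explicit (Site)

variable {d : ℕ} {𝔸 : Type*} [CStarAlgebra 𝔸] [Nontrivial 𝔸]

/-- No plaquette touches the empty region (private plumbing). [cite: Balaban1985RegularSpaces, p.77 (convention before (1.5))] -/
private theorem not_sideTouches_empty (y : Site d) (τ : Fin d) : ¬ SideTouches (∅ : Set (Site d)) y τ := by
  rintro ⟨z, κ, ν, -, hp, -⟩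
  simp [B8Ineq132.PlaqTouches] at hp

/-- The bounded site functions as a `ℂ`-submodule of all site functions (private plumbing). [cite: Balaban1985BackgroundPropagators, (3.24) p.394 (the carrier)] -/
private theorem bdd_submodule_exists (d : ℕ) (𝔸 : Type*) [CStarAlgebra 𝔸] :
    ∃ B : Submodule ℂ (Site d → 𝔸), (∀ f, f ∈ B ↔ BddS f) ∧ ∀ f ∈ B, star f ∈ B := by
  let B : Submodule ℂ (Site d → 𝔸) :=
    { carrier := {f | BddS f}
      add_mem' := fun ha hb => BddS.add ha hb
      zero_mem' := ⟨0, fun x => by simp⟩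
      smul_mem' := fun c f hf => BddS.smul c hf }
  exact ⟨B, fun f => Iff.rfl, fun f hf => BddS.star hf⟩

/-- ★★ **THE HONEST LETTERS `g, Δ, q, qs, 𝔄, C` AT AN EMPTY-TOWER MEMBER** (`Ω 0 = ℤᵈ`, `Ω j = ∅` for `j ≥ 1`; `d ≥ 1`, `η > 0`, unitary `U₀`): `g := G′ ⊕ η²·1_W` with
`G′ = ext ∘ (Δ^η_{U₀} + 8dη⁻²)⁻¹ ∘ restr` on the bounded submodule `B` and `W` a star-invariant complement, `Δ := Δ^η_{U₀}`, `q ∕ qs` the level-`0` embedding ∕ reading, `𝔄 := q ∘ (8dη⁻²·1_B ⊕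
(η⁻²·1 − Δ)∘1_W) ∘ qs`, `C := q ∘ g⁻¹ ∘ g⁻¹ ∘ qs` (`g⁻¹ = (Δ + 8dη⁻²) ⊕ η⁻²·1_W`) — with: the right-inverse law on ALL sources, the left-inverse law on bounded sources, the two `C`-laws,
the pinned readings, the bounds `‖g f‖ ≤ r`, `η‖∇_{U₀}g f‖ ≤ r` for `η²‖f‖ ≤ r`, reality, zero residual, and `g = G′` on every bounded source.  The letters do not depend on the truncation.
[cite: Balaban1985BackgroundPropagators, (3.23)–(3.25) p.394, Thm 3.1 p.397; Balaban1985RegularSpaces, (1.95)–(1.98) p.92, (1.101)–(1.103) p.93] -/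
theorem exists_honest_letters (hd : 1 ≤ d) {L : ℕ} {η : ℝ} (hη : 0 < η) {U₀ : Site d → Fin d → 𝔸ˣ} (hU₀ : ∀ x κ, U₀ x κ ∈ unitaryUnits 𝔸)
    {Ω : ℕ → Set (Site d)} (hΩ0 : Ω 0 = Set.univ) (hΩ : ∀ j, 1 ≤ j → Ω j = ∅) :
    ∃ (g Δ : (Site d → 𝔸) →ₗ[ℂ] (Site d → 𝔸)) (q : (Site d → 𝔸) →ₗ[ℂ] (ℕ → Site d → 𝔸))
      (qs : (ℕ → Site d → 𝔸) →ₗ[ℂ] (Site d → 𝔸)) (Aw c : (ℕ → Site d → 𝔸) →ₗ[ℂ] (ℕ → Site d → 𝔸)),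
      (∀ x : Site d → 𝔸, Δ (g x) + qs (Aw (q (g x))) = x) ∧
      (∀ x : Site d → 𝔸, BddS x → g (Δ x + qs (Aw (q x))) = x) ∧
      (∀ f, q (g (g (qs (c (q f))))) = q f) ∧ (∀ φ, qs (c (q (g (g (qs φ))))) = qs φ) ∧
      (∀ f x, Δ f x = covLap η U₀ f x) ∧ (∀ μ, qs μ = μ 0) ∧ (∀ f, q f 0 = f) ∧ (∀ f j, j ≠ 0 → q f j = 0) ∧
      (∀ (f : Site d → 𝔸) (r : ℝ), 0 ≤ r → (∀ y, wt L η 0 ^ 2 * ‖f y‖ ≤ r) →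
        (∀ y, ‖g f y‖ ≤ 1 * r) ∧ ∀ (y : Site d) (κ : Fin d), wt L η 0 * ‖covDerivFwd η U₀ κ (g f) y‖ ≤ 1 * r) ∧
      (∀ f : Site d → 𝔸, (∀ y, IsSelfAdjoint (f y)) → ∀ y, IsSelfAdjoint (g f y)) ∧
      (∀ f : Site d → 𝔸, f - g (qs (c (q (g f)))) = 0) ∧
      (∀ f : Site d → 𝔸, BddS f → g f = ⇑(fpS hd hη hU₀ (restrS f))) := by
  have hU1 : ∀ x κ, U₀ x κ ∈ U1 𝔸 := fun x κ => unitaryUnits_le_U1 (hU₀ x κ)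
  have hη2 : 0 < η ^ 2 := by positivity
  have hdpos : (0 : ℝ) < d := by exact_mod_cast hd
  -- the honest resolvent's clause package on bounded sources (p628670), read at truncation `0`
  obtain ⟨hres, hbd, hreal, hleft⟩ := massive_letter_clauses_on_bounded (𝔸 := 𝔸) hd hη hU₀ (L := L) (n := 0) hΩ0 hΩ le_rfl
  set G : (Site d → 𝔸) → Site d → 𝔸 := fun f => ⇑(fpS hd hη hU₀ (restrS f)) with hGdef
  -- the bounded submodule and a star-invariant complement
  obtain ⟨B, hBmem, hBstar⟩ := bdd_submodule_exists d 𝔸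
  obtain ⟨W, hc, hWstar⟩ := exists_isCompl_star B hBstar
  set PB := B.projection W hc with hPB
  set PW := W.projection B hc.symm with hPW
  have hsplit : ∀ x, PB x + PW x = x := Submodule.projection_add_projection_eq_self hc
  have hPBmem : ∀ x, BddS (PB x) := fun x => (hBmem _).1 (Submodule.projection_apply_mem hc x)
  have hPWmem : ∀ x, PW x ∈ W := fun x => Submodule.projection_apply_mem hc.symm x
  have hPB_of_bdd : ∀ f, BddS f → PB f = f := fun f hf => Submodule.projection_apply_of_mem_left hc ((hBmem f).2 hf)
  have hPW_of_bdd : ∀ f, BddS f → PW f = 0 := fun f hf => Submodule.projection_apply_of_mem_right hc.symm ((hBmem f).2 hf)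
  have hPB_of_W : ∀ w, w ∈ W → PB w = 0 := fun w hw => Submodule.projection_apply_of_mem_right hc hw
  have hPW_of_W : ∀ w, w ∈ W → PW w = w := fun w hw => Submodule.projection_apply_of_mem_left hc.symm hw
  -- scalars `s = η²`, `t = η⁻²`, mass `m = 8dη⁻²`
  set s : ℂ := ((η ^ 2 : ℝ) : ℂ) with hs
  have hs0 : s ≠ 0 := by rw [hs]; exact_mod_cast hη2.ne'
  set t : ℂ := s⁻¹ with ht
  have hts : t * s = 1 := inv_mul_cancel₀ hs0
  have hst : s * t = 1 := mul_inv_cancel₀ hs0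
  have hsstar : star s = s := by rw [hs]; exact Complex.conj_ofReal _
  set m : ℂ := ((massS d η : ℝ) : ℂ) with hm
  -- `G` is additive, homogeneous, star-compatible on bounded sources, and maps into bounded functions
  have hGbdd : ∀ f, BddS (G f) := fun f => bddS_coe _
  have hGadd : ∀ f g : Site d → 𝔸, BddS f → BddS g → G (f + g) = G f + G g := fun f g hf hg => by
    simp only [hGdef]; rw [restrS_add hf hg, fpS_add]; rfl
  have hGsmul : ∀ (c : ℂ) (f : Site d → 𝔸), BddS f → G (c • f) = c • G f := fun c f hf => by
    simp only [hGdef]; rw [restrS_smul c hf, fpS_smul]; rfl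
  have hGstar : ∀ f : Site d → 𝔸, BddS f → G (star f) = star (G f) := fun f hf => by
    have h := fpS_star hd hη hU₀ (restrS f)
    have hfe : (fun y => star ((restrS f) y)) = star f := funext fun y => by rw [restrS_apply hf]; rfl
    rw [hfe] at h
    simp only [hGdef]
    rw [← h]
    funext y
    rw [restrS_apply (bddS_coe _).star]; rfl
  -- the letter `Δ`
  let Δ : (Site d → 𝔸) →ₗ[ℂ] (Site d → 𝔸) :=
    { toFun := fun f x => covLap η U₀ f x
      map_add' := fun f g => funext fun x => covLap_add η U₀ f g x
      map_smul' := fun c f => funext fun x => by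
        simp only [RingHom.id_apply, Pi.smul_apply]; exact covLap_smul η U₀ c f x }
  have hΔ : ∀ f x, Δ f x = covLap η U₀ f x := fun _ _ => rfl
  have hΔbdd : ∀ f, BddS f → BddS (Δ f) := fun f ⟨C, hC⟩ => ⟨_, fun x => norm_covLap_le hη hU1 hC x⟩
  -- the letter `g := G ∘ P_B + s·P_W` and its inverse `g⁻¹ := (Δ + m) ∘ P_B + t·P_W`
  let gB : (Site d → 𝔸) →ₗ[ℂ] (Site d → 𝔸) :=
    { toFun := fun x => G (PB x)
      map_add' := fun x y => by rw [map_add, hGadd _ _ (hPBmem x) (hPBmem y)]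
      map_smul' := fun c x => by rw [map_smul, hGsmul c _ (hPBmem x)]; rfl }
  let g : (Site d → 𝔸) →ₗ[ℂ] (Site d → 𝔸) := gB + s • PW
  let T : (Site d → 𝔸) →ₗ[ℂ] (Site d → 𝔸) := Δ + m • LinearMap.id
  let ginv : (Site d → 𝔸) →ₗ[ℂ] (Site d → 𝔸) := T ∘ₗ PB + t • PW
  have hgapp : ∀ x, g x = G (PB x) + s • PW x := fun _ => rfl
  have hginv : ∀ x, ginv x = T (PB x) + t • PW x := fun _ => rfl
  have hTapp : ∀ f, T f = Δ f + m • f := fun _ => rfl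
  have hTbdd : ∀ f, BddS f → BddS (T f) := fun f hf => by rw [hTapp]; exact (hΔbdd f hf).add (hf.smul m)
  have hg_bdd : ∀ f, BddS f → g f = G f := fun f hf => by rw [hgapp, hPB_of_bdd f hf, hPW_of_bdd f hf, smul_zero, add_zero]
  have hTG : ∀ b, BddS b → T (G b) = b := fun b hb => by
    funext y; rw [hTapp, Pi.add_apply, Pi.smul_apply, hΔ]; exact hres b hb y
  have hGT : ∀ b, BddS b → G (T b) = b := fun b hb => by
    have h := hleft b hb
    have hTe : T b = fun y => covLap η U₀ b y + (massS d η : ℂ) • b y := by funext y; rw [hTapp, Pi.add_apply, Pi.smul_apply, hΔ]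
    rw [hTe]; exact h
  have hG0 : G 0 = 0 := by
    have h := hGsmul 0 0 ⟨0, fun y => by simp⟩
    rwa [zero_smul, zero_smul] at h
  have hgginv : ∀ x, g (ginv x) = x := fun x => by
    have hb : BddS (T (PB x)) := hTbdd _ (hPBmem x)
    have hw : t • PW x ∈ W := W.smul_mem _ (hPWmem x)
    rw [hginv, map_add, hgapp, hgapp, hPB_of_bdd _ hb, hPW_of_bdd _ hb, hPB_of_W _ hw, hPW_of_W _ hw, smul_zero, add_zero, hGT _ (hPBmem x),
      smul_smul, hst, one_smul, hG0, zero_add, hsplit]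
  have hginvg : ∀ x, ginv (g x) = x := fun x => by
    have hb : BddS (G (PB x)) := hGbdd _
    have hw : s • PW x ∈ W := W.smul_mem _ (hPWmem x)
    rw [hgapp, map_add, hginv, hginv, hPB_of_bdd _ hb, hPW_of_bdd _ hb, hPB_of_W _ hw, hPW_of_W _ hw, smul_zero, add_zero, hTG _ (hPBmem x),
      map_zero, zero_add, smul_smul, hts, one_smul, hsplit]
  -- the remaining letters
  let q : (Site d → 𝔸) →ₗ[ℂ] (ℕ → Site d → 𝔸) := LinearMap.single ℂ (fun _ : ℕ => Site d → 𝔸) 0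
  let qs : (ℕ → Site d → 𝔸) →ₗ[ℂ] (Site d → 𝔸) := LinearMap.proj 0
  let M : (Site d → 𝔸) →ₗ[ℂ] (Site d → 𝔸) := (m • PB) + (t • PW - Δ ∘ₗ PW)
  let Aw : (ℕ → Site d → 𝔸) →ₗ[ℂ] (ℕ → Site d → 𝔸) := q ∘ₗ M ∘ₗ qs
  let c : (ℕ → Site d → 𝔸) →ₗ[ℂ] (ℕ → Site d → 𝔸) := q ∘ₗ (ginv ∘ₗ ginv) ∘ₗ qs
  have hq : ∀ f, q f = Pi.single (0 : ℕ) f := fun _ => rfl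
  have hq0 : ∀ f, q f 0 = f := fun f => by rw [hq, Pi.single_eq_same]
  have hqj : ∀ f j, j ≠ 0 → q f j = 0 := fun f j hj => by rw [hq, Pi.single_eq_of_ne hj]
  have hqs : ∀ μ, qs μ = μ 0 := fun _ => rfl
  have hqsq : ∀ f, qs (q f) = f := fun f => by rw [hqs, hq0]
  have hM : ∀ x, M x = m • PB x + (t • PW x - Δ (PW x)) := fun _ => rfl
  have hAwq : ∀ u, qs (Aw (q u)) = M u := fun u => by
    show qs (q (M (qs (q u)))) = _
    rw [hqsq, hqsq]
  -- `Δ ∘ g + M ∘ g = 1` on all sources and `Δ + M = T` on bounded ones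
  have hright : ∀ x, Δ (g x) + M (g x) = x := fun x => by
    have hb : BddS (G (PB x)) := hGbdd _
    have h2 : Δ (G (PB x)) + m • G (PB x) = PB x := hTG _ (hPBmem x)
    calc Δ (g x) + M (g x) = (Δ (G (PB x)) + m • G (PB x)) + PW x := by
          rw [hM, hgapp]
          simp only [map_add, map_smul, hPB_of_bdd _ hb, hPW_of_bdd _ hb, hPB_of_W _ (hPWmem x), hPW_of_W _ (hPWmem x), smul_zero, add_zero,
            zero_add, smul_smul, hts, one_smul]
          abel
      _ = x := by rw [h2, hsplit]
  have hMbdd : ∀ x, BddS x → Δ x + M x = T x := fun x hx => by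
    rw [hM, hPB_of_bdd x hx, hPW_of_bdd x hx, smul_zero, map_zero, sub_zero, add_zero, hTapp]
  -- the level-`0` bounds
  have hder : ∀ (f : Site d → 𝔸) (r : ℝ), (∀ y, ‖f y‖ ≤ r) → ∀ (x : Site d) (κ : Fin d), wt L η 0 * ‖covDerivFwd η U₀ κ f x‖ ≤ 2 * r := by
    intro f r hr x κ
    have h1 : ‖covDerivFwd η U₀ κ f x‖ ≤ η⁻¹ * (2 * r) :=
      (norm_covDerivFwd_le hη (hU1 x κ) f).trans (mul_le_mul_of_nonneg_left (by linarith [hr (x + e κ), hr x]) (inv_nonneg.mpr hη.le))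
    simp only [wt, pow_zero, one_mul]
    calc η * ‖covDerivFwd η U₀ κ f x‖ ≤ η * (η⁻¹ * (2 * r)) := mul_le_mul_of_nonneg_left h1 hη.le
      _ = 2 * r := by field_simp
  refine ⟨g, Δ, q, qs, Aw, c, fun x => by rw [hAwq]; exact hright x, fun x hx => ?_, fun f => ?_, fun φ => ?_, hΔ, hqs, hq0, hqj,
    fun f r hr hf => ?_, fun f hf y => ?_, fun f => ?_, hg_bdd⟩
  · -- left inverse on bounded sources: `g (T x) = G (T x) = x`
    rw [hAwq, hMbdd x hx, hg_bdd _ (hTbdd x hx), hGT x hx]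
  · show q (g (g (qs (q (ginv (ginv (qs (q f)))))))) = q f
    rw [hqsq, hqsq, hgginv, hgginv]
  · show qs (q (ginv (ginv (qs (q (g (g (qs φ)))))))) = qs φ
    rw [hqsq, hqsq, hginvg, hginvg]
  · -- bounds of `g = G′` for `η²‖f‖ ≤ r`
    have hfb : ∀ y, ‖f y‖ ≤ (η ^ 2)⁻¹ * r := fun y => by
      have h := hf y
      simp only [wt, pow_zero, one_mul] at h
      rw [inv_mul_eq_div, le_div_iff₀ hη2]; linarith
    have hfB : BddS f := ⟨_, hfb⟩
    have hBd : Bd2 (𝔸 := 𝔸) L η 0 Ω f r := fun j hj x _ => by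
      obtain rfl : j = 0 := Nat.le_zero.mp hj
      exact hf x
    obtain ⟨h1, h2⟩ := hbd f r hr hBd
    rw [hg_bdd f hfB]
    exact ⟨h1, h2⟩
  · -- reality: `g(f*) = (g f)*` by `G′`'s adjoint-compatibility and the STAR-INVARIANT splitting
    have hfsa : star f = f := funext fun y => (hf y).star_eq
    have hPBs : PB (star f) = star (PB f) := projection_star hc hBstar hWstar f
    have hPWs : PW (star f) = star (PW f) := by
      rw [hPW, Submodule.projection_eq_self_sub_projection hc, Submodule.projection_eq_self_sub_projection hc, hPBs, star_sub]
    have hgs : g f = star (g f) := by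
      conv_lhs => rw [← hfsa]
      rw [hgapp, hgapp, hPBs, hPWs, hGstar _ (hPBmem f), star_add, star_smul, hsstar]
    show star (g f y) = g f y
    have hy := congrArg (fun u : Site d → 𝔸 => u y) hgs
    simp only [Pi.star_apply] at hy
    exact hy.symm
  · show f - g (qs (q (ginv (ginv (qs (q (g f))))))) = 0
    rw [hqsq, hqsq, hgginv, hginvg, sub_self]

/-- ★★ **`SockLettersRD` ON THE EMPTY-TOWER SUB-CLASS WITH THE GENUINE RESOLVENT** — `d ≥ 1`, any `L`, every `η > 0`, every depth `k`, `Ω 0 = ℤᵈ`, `Ω j = ∅` (`j ≥ 1`), `Λs n 0 = ℤᵈ`,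
`Λs n j = ∅` (`1 ≤ j ≤ n ≤ k`), any `cP`: `SockLettersRD L 1 0 2 (4d) cP η k Ω Λs`, the letters of `exists_honest_letters` (so `g = G′ = (Δ^η_{U₀} + 8dη⁻²)⁻¹` on every bounded source,
`𝔄 = 8dη⁻²`, `C = G′⁻²`, `R = 0` there) and `H′X := X(0, ·)`. [cite: Balaban1985BackgroundPropagators, (3.23)–(3.25) p.394, Thm 3.1 p.397; Balaban1985RegularSpaces, (1.91)–(1.92) p.91, (1.95)–(1.98) p.92, (1.101)–(1.103) p.93, (1.107) p.94] -/
theorem sockLettersRD_emptyTower_honest (hd : 1 ≤ d) {L : ℕ} {η : ℝ} (hη : 0 < η) {k : ℕ} {Ω : ℕ → Set (Site d)} {Λs : ℕ → ℕ → Set (Site d)}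
    (hΩ0 : Ω 0 = Set.univ) (hΩ : ∀ j, 1 ≤ j → Ω j = ∅) (hΛ0 : ∀ n, 1 ≤ n → n ≤ k → Λs n 0 = Set.univ)
    (hΛ : ∀ n j, 1 ≤ n → n ≤ k → 1 ≤ j → j ≤ n → Λs n j = ∅) (cP : ℝ) :
    SockLettersRD (𝔸 := 𝔸) L 1 0 2 (4 * d) cP η k Ω Λs := by
  intro α₀ _ _ U₀ hU₀ _ n hn1 hnk
  have hU1 : ∀ x κ, U₀ x κ ∈ U1 𝔸 := fun x κ => unitaryUnits_le_U1 (hU₀ x κ)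
  have hη2 : 0 < η ^ 2 := by positivity
  have hΛn0 : Λs n 0 = Set.univ := hΛ0 n hn1 hnk
  have hΛe : ∀ j, 1 ≤ j → j ≤ n → Λs n j = ∅ := fun j hj hjn => hΛ n j hn1 hnk hj hjn
  obtain ⟨g, Δ, q, qs, Aw, c, h1, -, h2, -, hΔ, hqs, hq0, -, h12, h14, h15, -⟩ := exists_honest_letters (L := L) hd hη hU₀ hΩ0 hΩ
  let H' : XSpace d n 𝔸 →ₗ[ℂ] (Site d → 𝔸) :=
    { toFun := fun X x => X ((0 : Fin (n + 1)), x)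
      map_add' := fun X Y => funext fun x => by simp
      map_smul' := fun c X => funext fun x => by simp }
  have hH : ∀ (X : XSpace d n 𝔸) x, H' X x = X (0, x) := fun _ _ => rfl
  have hHn : ∀ (X : XSpace d n 𝔸) x, ‖H' X x‖ ≤ ‖X‖ := fun X x => by rw [hH]; exact X.norm_coe_le_norm (0, x)
  have hder : ∀ (f : Site d → 𝔸) (r : ℝ), (∀ y, ‖f y‖ ≤ r) → ∀ (x : Site d) (κ : Fin d), wt L η 0 * ‖covDerivFwd η U₀ κ f x‖ ≤ 2 * r := by
    intro f r hr x κ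
    have h1 : ‖covDerivFwd η U₀ κ f x‖ ≤ η⁻¹ * (2 * r) :=
      (norm_covDerivFwd_le hη (hU1 x κ) f).trans (mul_le_mul_of_nonneg_left (by linarith [hr (x + e κ), hr x]) (inv_nonneg.mpr hη.le))
    simp only [wt, pow_zero, one_mul]
    calc η * ‖covDerivFwd η U₀ κ f x‖ ≤ η * (η⁻¹ * (2 * r)) := mul_le_mul_of_nonneg_left h1 hη.le
      _ = 2 * r := by field_simp
  have hlap : ∀ (f : Site d → 𝔸) (r : ℝ), (∀ y, ‖f y‖ ≤ r) → ∀ x : Site d, wt L η 0 ^ 2 * ‖covLap η U₀ f x‖ ≤ 4 * d * r := by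
    intro f r hr x
    have h := norm_covLap_le hη hU1 hr x
    simp only [wt, pow_zero, one_mul]
    calc η ^ 2 * ‖covLap η U₀ f x‖ ≤ η ^ 2 * (4 * d * (η⁻¹ * (η⁻¹ * r))) := mul_le_mul_of_nonneg_left h hη2.le
      _ = 4 * d * r := by field_simp
  have hside : ∀ j, j ≤ n → ∀ (p : Site d × Fin d), SideTouches (Ω j) p.1 p.2 → j = 0 := by
    intro j _ p hp
    by_contra hj
    rw [hΩ j (Nat.one_le_iff_ne_zero.mpr hj)] at hp
    exact not_sideTouches_empty p.1 p.2 hp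
  refine ⟨g, Δ, q, qs, Aw, c, H', fun x y _ => ?_, h2, fun f x _ => ?_, fun μ x _ => ?_, fun f j hj y hy => ?_, fun X x => ?_, fun j hj X p hp => ?_,
    fun X j hj x hx => ?_, fun X x hx => ?_, fun X Y hXY x => ?_, fun Y j hj y hy => ?_, fun f r hr hf => ?_, fun f x hx => ?_, fun f hf x => ?_,
    fun f r _ _ j _ x _ => ?_, fun f _ j _ x _ => ?_⟩
  · rw [h1 x]
  · rw [hΔ, hΩ0, Set.indicator_univ]
  · rw [hqs, QT, Finset.sum_eq_single 0 (fun j hjr hj => ?_) (fun h => absurd (Finset.mem_range.mpr (Nat.succ_pos n)) h), hΛn0, Set.indicator_univ]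
    · rfl
    · rw [hΛe j (Nat.one_le_iff_ne_zero.mpr hj) (Nat.lt_succ_iff.mp (Finset.mem_range.mp hjr)), Set.indicator_empty]; exact QprimeT_zero L U₀ j x
  · rcases Nat.eq_zero_or_pos j with rfl | hjp
    · rw [hq0]; rfl
    · rw [hΛe j hjp hj] at hy; exact absurd hy (Set.notMem_empty y)
  · exact (hHn X x).trans (le_mul_of_one_le_left (norm_nonneg X) (by norm_num))
  · obtain rfl := hside j hj p hp
    exact hder (H' X) ‖X‖ (hHn X) p.1 p.2
  · rcases Nat.eq_zero_or_pos j with rfl | hjp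
    · exact hlap (H' X) ‖X‖ (hHn X) x
    · rw [hΩ j hjp] at hx; exact absurd hx (Set.notMem_empty x)
  · rw [hΩ0] at hx; exact absurd (Set.mem_univ x) hx
  · rw [hH, hH, hXY]
  · rcases Nat.eq_zero_or_pos j with rfl | hjp
    · rfl
    · rw [hΛe j hjp hj] at hy; exact absurd hy (Set.notMem_empty y)
  · -- (12): `Bd2 f r` at this member reads at level `0` only
    have hf0 : ∀ y, wt L η 0 ^ 2 * ‖f y‖ ≤ r := fun y => hf 0 (Nat.zero_le n) y (by rw [hΩ0]; exact Set.mem_univ y)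
    obtain ⟨ha, hb⟩ := h12 f r hr hf0
    refine ⟨ha, fun j hj p hp => ?_⟩
    obtain rfl := hside j hj p hp
    exact hb p.1 p.2
  · rw [hΩ0] at hx; exact absurd (Set.mem_univ x) hx
  · exact h14 f (fun y => hf 0 (Nat.zero_le n) y (by rw [hΩ0]; exact Set.mem_univ y)) x
  · rw [h15 f, Pi.zero_apply, norm_zero, mul_zero, zero_mul]
  · rw [h15 f, Pi.zero_apply]
    exact IsSelfAdjoint.zero _

/-- ★ **THE UNIQUENESS-SIDE DISPLAY (`SLetUB` of p619291) ON THE EMPTY-TOWER SUB-CLASS WITH THE SAME HONEST LETTERS** (bounded LEFT inverse `g (Δx + Q′ᵀ𝔄Q′x) = x` for bounded `x`,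
`Q′ᵀCQ′ g g Q′ᵀ = Q′ᵀ`, «`q = 0` off the tower» editions of the clauses), constants `(B_G, B_R, B₀′_H, B₂′) = (1, 0, 2, 4d)`, at the top truncation `k` (`Λs k 0 = ℤᵈ`, `Λs k j = ∅` for
`1 ≤ j ≤ k`). [cite: Balaban1985BackgroundPropagators, (3.23)–(3.25) p.394, Thm 3.1 p.397; Balaban1985RegularSpaces, (1.107)–(1.109) p.94] -/
theorem sLetUB_text_emptyTower_honest (hd : 1 ≤ d) {L : ℕ} {η : ℝ} (hη : 0 < η) {k : ℕ} {Ω : ℕ → Set (Site d)} {Λs : ℕ → ℕ → Set (Site d)}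
    (hΩ0 : Ω 0 = Set.univ) (hΩ : ∀ j, 1 ≤ j → Ω j = ∅) (hΛ0 : Λs k 0 = Set.univ) (hΛ : ∀ j, 1 ≤ j → j ≤ k → Λs k j = ∅) (cL : ℝ) :
    ∀ α₀ : ℝ, 0 < α₀ → α₀ ≤ cL → ∀ U₀ : Site d → Fin d → 𝔸ˣ, (∀ x κ, U₀ x κ ∈ unitaryUnits 𝔸) → InAk L k η α₀ Ω U₀ →
      ∃ (g Δ : (Site d → 𝔸) →ₗ[ℂ] (Site d → 𝔸)) (q : (Site d → 𝔸) →ₗ[ℂ] (ℕ → Site d → 𝔸))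
        (qs : (ℕ → Site d → 𝔸) →ₗ[ℂ] (Site d → 𝔸)) (Aw c : (ℕ → Site d → 𝔸) →ₗ[ℂ] (ℕ → Site d → 𝔸))
        (H' : XSpace d k 𝔸 →ₗ[ℂ] (Site d → 𝔸)),
        (∀ x : Site d → 𝔸, (∃ C : ℝ, ∀ y, ‖x y‖ ≤ C) → g (Δ x + qs (Aw (q x))) = x) ∧ (∀ φ, qs (c (q (g (g (qs φ))))) = qs φ) ∧
        (∀ (f : Site d → 𝔸), ∀ x ∈ Ω 0, Δ f x = covLap η U₀ ((Ω 0).indicator f) x) ∧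
        (∀ (μ : ℕ → Site d → 𝔸), ∀ x ∈ Ω 0, qs μ x = QT L k (Λs k) U₀ μ x) ∧
        (∀ (f : Site d → 𝔸) (n : ℕ), n ≤ k → ∀ y ∈ Λs k n, q f n y = QprimeIter (zdBlocking d L) (bgT L U₀) n f y) ∧
        (∀ (f : Site d → 𝔸) (n : ℕ) (y : Site d), ¬ (n ≤ k ∧ y ∈ Λs k n) → q f n y = 0) ∧
        (∀ (X : XSpace d k 𝔸) (x : Site d), ‖H' X x‖ ≤ 2 * ‖X‖) ∧
        (∀ n, n ≤ k → ∀ (X : XSpace d k 𝔸), ∀ p ∈ {b : Site d × Fin d | SideTouches (Ω n) b.1 b.2},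
          wt L η n * ‖covDerivFwd η U₀ p.2 (H' X) p.1‖ ≤ 2 * ‖X‖) ∧
        (∀ X : XSpace d k 𝔸, Bd2 L η k Ω (covLap η U₀ (H' X)) ((4 * d) * ‖X‖)) ∧
        (∀ (Y : XSpace d k 𝔸) (n : ℕ) (hn : n ≤ k) (y : Site d), y ∈ Λs k n →
          QprimeIter (zdBlocking d L) (bgT L U₀) n (H' Y) y = Y (⟨n, Nat.lt_succ_of_le hn⟩, y)) ∧
        (∀ (f : Site d → 𝔸) (r : ℝ), 0 ≤ r → Bd2 L η k Ω f r →
          (∀ x, ‖g f x‖ ≤ 1 * r) ∧ ∀ n, n ≤ k → ∀ p ∈ {b : Site d × Fin d | SideTouches (Ω n) b.1 b.2},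
            wt L η n * ‖covDerivFwd η U₀ p.2 (g f) p.1‖ ≤ 1 * r) ∧
        (∀ (f : Site d → 𝔸) (r : ℝ), 0 ≤ r → Bd2 L η k Ω f r → Bd2 L η k Ω (f - g (qs (c (q (g f))))) (0 * r)) := by
  intro α₀ _ _ U₀ hU₀ _
  have hU1 : ∀ x κ, U₀ x κ ∈ U1 𝔸 := fun x κ => unitaryUnits_le_U1 (hU₀ x κ)
  have hη2 : 0 < η ^ 2 := by positivity
  obtain ⟨g, Δ, q, qs, Aw, c, -, h1b, -, h2b, hΔ, hqs, hq0, hqj, h12, -, h15, -⟩ := exists_honest_letters (L := L) hd hη hU₀ hΩ0 hΩ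
  let H' : XSpace d k 𝔸 →ₗ[ℂ] (Site d → 𝔸) :=
    { toFun := fun X x => X ((0 : Fin (k + 1)), x)
      map_add' := fun X Y => funext fun x => by simp
      map_smul' := fun c X => funext fun x => by simp }
  have hH : ∀ (X : XSpace d k 𝔸) x, H' X x = X (0, x) := fun _ _ => rfl
  have hHn : ∀ (X : XSpace d k 𝔸) x, ‖H' X x‖ ≤ ‖X‖ := fun X x => by rw [hH]; exact X.norm_coe_le_norm (0, x)
  have hder : ∀ (f : Site d → 𝔸) (r : ℝ), (∀ y, ‖f y‖ ≤ r) → ∀ (x : Site d) (κ : Fin d), wt L η 0 * ‖covDerivFwd η U₀ κ f x‖ ≤ 2 * r := by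
    intro f r hr x κ
    have h1 : ‖covDerivFwd η U₀ κ f x‖ ≤ η⁻¹ * (2 * r) :=
      (norm_covDerivFwd_le hη (hU1 x κ) f).trans (mul_le_mul_of_nonneg_left (by linarith [hr (x + e κ), hr x]) (inv_nonneg.mpr hη.le))
    simp only [wt, pow_zero, one_mul]
    calc η * ‖covDerivFwd η U₀ κ f x‖ ≤ η * (η⁻¹ * (2 * r)) := mul_le_mul_of_nonneg_left h1 hη.le
      _ = 2 * r := by field_simp
  have hlap : ∀ (f : Site d → 𝔸) (r : ℝ), (∀ y, ‖f y‖ ≤ r) → ∀ x : Site d, wt L η 0 ^ 2 * ‖covLap η U₀ f x‖ ≤ 4 * d * r := by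
    intro f r hr x
    have h := norm_covLap_le hη hU1 hr x
    simp only [wt, pow_zero, one_mul]
    calc η ^ 2 * ‖covLap η U₀ f x‖ ≤ η ^ 2 * (4 * d * (η⁻¹ * (η⁻¹ * r))) := mul_le_mul_of_nonneg_left h hη2.le
      _ = 4 * d * r := by field_simp
  have hside : ∀ j, j ≤ k → ∀ (p : Site d × Fin d), SideTouches (Ω j) p.1 p.2 → j = 0 := by
    intro j _ p hp
    by_contra hj
    rw [hΩ j (Nat.one_le_iff_ne_zero.mpr hj)] at hp
    exact not_sideTouches_empty p.1 p.2 hp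
  refine ⟨g, Δ, q, qs, Aw, c, H', fun x hx => h1b x hx, h2b, fun f x _ => ?_, fun μ x _ => ?_, fun f j hj y hy => ?_, fun f j y hjy => ?_, fun X x => ?_,
    fun j hj X p hp => ?_, fun X j hj x hx => ?_, fun Y j hj y hy => ?_, fun f r hr hf => ?_, fun f r _ _ j _ x _ => ?_⟩
  · rw [hΔ, hΩ0, Set.indicator_univ]
  · rw [hqs, QT, Finset.sum_eq_single 0 (fun j hjr hj => ?_) (fun h => absurd (Finset.mem_range.mpr (Nat.succ_pos k)) h), hΛ0, Set.indicator_univ]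
    · rfl
    · rw [hΛ j (Nat.one_le_iff_ne_zero.mpr hj) (Nat.lt_succ_iff.mp (Finset.mem_range.mp hjr)), Set.indicator_empty]; exact QprimeT_zero L U₀ j x
  · rcases Nat.eq_zero_or_pos j with rfl | hjp
    · rw [hq0]; rfl
    · rw [hΛ j hjp hj] at hy; exact absurd hy (Set.notMem_empty y)
  · -- `q = 0` off the tower: the tower holds every `(0, y)`, and `q f j = 0` for `j ≥ 1`
    rcases Nat.eq_zero_or_pos j with rfl | hjp
    · exact absurd ⟨Nat.zero_le k, by rw [hΛ0]; exact Set.mem_univ y⟩ hjy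
    · rw [hqj f j (by omega)]; rfl
  · exact (hHn X x).trans (le_mul_of_one_le_left (norm_nonneg X) (by norm_num))
  · obtain rfl := hside j hj p hp
    exact hder (H' X) ‖X‖ (hHn X) p.1 p.2
  · rcases Nat.eq_zero_or_pos j with rfl | hjp
    · exact hlap (H' X) ‖X‖ (hHn X) x
    · rw [hΩ j hjp] at hx; exact absurd hx (Set.notMem_empty x)
  · rcases Nat.eq_zero_or_pos j with rfl | hjp
    · rfl
    · rw [hΛ j hjp hj] at hy; exact absurd hy (Set.notMem_empty y)
  · have hf0 : ∀ y, wt L η 0 ^ 2 * ‖f y‖ ≤ r := fun y => hf 0 (Nat.zero_le k) y (by rw [hΩ0]; exact Set.mem_univ y)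
    obtain ⟨ha, hb⟩ := h12 f r hr hf0
    refine ⟨ha, fun j hj p hp => ?_⟩
    obtain rfl := hside j hj p hp
    exact hb p.1 p.2
  · rw [h15 f, Pi.zero_apply, norm_zero, mul_zero, zero_mul]

/-! ## §3 At the binder shape and on the index of record -/

/-- ★ **AT THE BINDER SHAPE OF THE P₂D SLOT, WITH THE GENUINE RESOLVENT**: a member `i : ZdIdx d L` (`d ≥ 1`) obeying the located laws, (1.3)–(1.4) and the (1.5) face whose domains
are the empty tower satisfies `SockLettersRD L 1 0 2 (4d) cP i.η i.k i.Ω i.Λs` with `g = G′` on bounded sources (families forced by rigidity, as in the degenerate edition).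
[cite: Balaban1985RegularSpaces, (1.3)–(1.6) p.77, (1.95)–(1.98) p.92, (1.101) p.93; Balaban1985BackgroundPropagators, Thm 3.1 p.397] -/
theorem sockLettersRD_of_lamTop_emptyTower_honest (hd : 1 ≤ d) {L : ℕ} (hL : 1 ≤ L) (i : ZdIdx d L) (hlaws : IdxB8Laws L i) (hΩ : DomainSeq L i.Ω)
    (hΛ : ∀ j, j < i.k → ∀ z ∈ i.Λs i.k j, ((L : ℤ) ^ j) • z ∈ Lam L i.Ω j)
    (hΩ0 : i.Ω 0 = Set.univ) (hΩe : ∀ j, 1 ≤ j → i.Ω j = ∅) (cP : ℝ) :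
    SockLettersRD (𝔸 := 𝔸) L 1 0 2 (4 * d) cP i.η i.k i.Ω i.Λs := by
  refine sockLettersRD_emptyTower_honest hd i.hη hΩ0 hΩe (fun n hn1 hnk => ?_) (fun n j hn1 hnk hj hjn => ?_) cP
  · rw [Λs_eq_lam_of_lamTop hL i hlaws hΩ hΛ hnk (Nat.zero_le n)]
    ext y
    rw [mem_lamK_iff_of_lt L i.Ω (by omega) y]
    simp only [Set.mem_univ, iff_true]
    refine ⟨isLevel_pow_smul L 0 y, by rw [hΩ0]; exact Set.mem_univ _, by rw [hΩe 1 le_rfl]; exact Set.notMem_empty _⟩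
  · rw [Λs_eq_lam_of_lamTop hL i hlaws hΩ hΛ hnk hjn]
    ext y
    simp only [Set.mem_empty_iff_false, iff_false]
    rcases hjn.lt_or_eq with hlt | rfl
    · rw [mem_lamK_iff_of_lt L i.Ω hlt y]
      exact fun h => by have h2 : ((L : ℤ) ^ j) • y ∈ i.Ω j := h.2.1; rw [hΩe j hj] at h2; exact h2
    · rw [mem_lamK_self_iff L i.Ω j y, hΩe j hj]
      exact Set.notMem_empty _

/-- **ON THE INDEX OF RECORD**: every `j : IdxB8SubD θ` whose domains are the empty tower satisfies `SockLettersRD θ.L 1 0 2 (4·θ.D) cP j.η j.k j.Ω j.Λs` with the genuine resolvent on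
bounded sources (`θ.D = d₆ + 1 ≥ 1`). [cite: Balaban1985RegularSpaces, (1.3)–(1.6) p.77; Balaban1985BackgroundPropagators, Thm 3.1 p.397] -/
theorem IdxB8SubD.sockLettersRD_of_emptyTower_honest {θ : Stage3Params} (j : IdxB8SubD θ) (hΩe : ∀ l, 1 ≤ l → j.1.1.1.1.Ω l = ∅) (cP : ℝ) :
    SockLettersRD (𝔸 := θ.𝔸) θ.L 1 0 2 (4 * θ.D) cP j.1.1.1.1.η j.1.1.1.1.k j.1.1.1.1.Ω j.1.1.1.1.Λs :=
  sockLettersRD_of_lamTop_emptyTower_honest (by rw [← θ.hd₆]; exact Nat.succ_pos _) (le_trans (by norm_num) θ.two_le_L) j.1.1.1.1 j.laws j.domainSeq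
    j.lamTop j.Ω_zero hΩe cP

end Honest

end Literature.MathematicalPhysics.QuantumFieldTheory.Balaban1983to89.B8SockLettersRDEmptyTowerClassHonest

end
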